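import Summits.RiemannHypothesis.RiemannHypothesis.Theses.HardyZLehmerSplit
import Literature.NumberTheory.LFunctions.HardyZExtremaCriterionProofs
import Literature.NumberTheory.LFunctions.ZetaZeroWindowsExplicit
import Literature.NumberTheory.LFunctions.ZetaLogDerivRePartialFraction
import Literature.NumberTheory.LFunctions.ZetaLogDerivRealBound
import Literature.Analysis.SpecialFunctions.DigammaLogBound
import HarnessLib

/-!
# Line `dictionary_v1` for crux `HardyZLehmerSplit.Dictionary` (stmt-RiemannHypothesis-24248) — RH-FREE

Route `route-RiemannHypothesis-HardyZLehmerSplit` (Theses/HardyZLehmerSplit.lean rev 0, commit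
4957a5c44c51, sha16 9ff90537fff6a524; `closes : HeightPT → SigmaL → Dictionary → SigmaRest → RH`).
This file is the LINE PLANNER's skeleton (unit plan-w07-dict-1 g0, remit (CA132)): five registered
`stub_*` lemmas (sorry ONLY there) and the kernel-checked composition
`Dictionary_of : HardyZLehmerSplit.Dictionary` (the item BY NAME), whose proof invokes the five stubs
by name and is otherwise sorry-free explicit arithmetic (stubA → stubB → stubC → stubD → stubE → crux).
Nothing here bears on the truth of RH: every stub is an unconditional, explicit statement about
`ζ`, `Z` and the zero-counting function; no Σ-hypothesis, no RH.

## The crux (verbatim, route decl l.240)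

For `γ > 3 000 175 332 800`, `0 < δ < 1/2`, `ζ(½+δ+iγ) = 0`, `δ·log²γ ≤ 1/4`, and every zero of `ζ` in
the open strip within `π/log γ` of height `γ` equal to one of `½±δ+iγ`: there is `t`, `|t−γ| < π/log γ`,
at which Hardy's `Z` has a positive local minimum or a negative local maximum (a Lehmer violation).

## Strategy — why this line reaches `Dictionary` (Titchmarsh §9.6, SECOND proof of Thm 9.6 (A))

`Z'/Z(t) = −Im ζ'/ζ(½+it)` (tree `Ivic2003.deriv_hardyZ_div_eq`).  Instead of a Landau /
Borel–Carathéodory DISC lemma (Titchmarsh's first proof via Lemma α of §3.9; the C1² birth file's stub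
E1 `LogDerivLocalWith A T₂`, whose explicit constant `A` needs |ζ|-growth in a disc reaching σ ≤ 0 and
was graded the hardest step — critic g15 CONSTANTS WORD, rh-split STATUS l.5346), this line uses the
GLOBAL Hadamard partial fraction of `ξ'/ξ` DIFFERENCED at the comparison point `s₀ = 2 + it`
(Titchmarsh p. 217–218 = PDF p.158–159: "Another proof depends on (2.12.7) … Replacing s by 2+it and
subtracting"; Davenport Ch. 15):

  `Z'/Z(t) = Σ_ρ m(ρ)·K(t,ρ) + smoothPart t`,  `K(t,ρ) = −Im[1/(½+it−ρ) − 1/(2+it−ρ)]`,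

the sum over the distinct non-trivial zeros with multiplicity `m = riemannZetaZeroOrder`, ABSOLUTELY
convergent (`|K| ≤ (3/2)/|t−γ′|²` off the window), and `smoothPart` = `−Im ζ'/ζ(2+it)` + pole terms +
`½ Im[ψ(¼+it/2) − ψ(1+it/2)]`, which is `O(1)` with NO growth input on ζ (|ζ'/ζ(2+it)| < 1, Ford's
Lemma 3.1 in the tree).  The `O(log t)` of (9.6.1) therefore comes from ZERO COUNTING ALONE, which the
tree has in explicit form (`zetaZeroCount_window_le_three_log`: N(u+1) − N(u) ≤ 3 log(|u|+2);
`ZetaZeroWindows.count_diff_le_explicit`).  Split the zero sum at the window `t−1 < Im ρ ≤ t+1`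
(`window t = zetaZeroBox 0 (t+1) \ zetaZeroBox 0 (t−1)`):

* stub A `stub_partialFraction` [L] — the exact decomposition `Z'/Z = windowSum + farSum + smoothPart`;
* stub B `stub_farField` [L] — `|farSum t| ≤ 20 log t + 50` (t ≥ 100) by unit shells
  `Σ_n (3/2)/n² · 3 log(t+n+2)` (Titchmarsh p.159 display "Σ log(t+n)/n² = O(log t)");
* stub C `stub_smoothBound` [M] — `|smoothPart t| ≤ 3` (t ≥ 100): digamma series + Ford L3.1;
* stub D `stub_clusterSigns` [M] — under the crux's pair + isolation hypotheses (radius r ≥ 2δ),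
  at `t = γ ± δ` the two pair zeros contribute `±(1/δ − O(δ))` to `windowSum` and every other window
  zero at most `m·(1/(r−δ) + 1/2)`, the total multiplicity being `N(t+1) − N(t−1)` — one-sided bounds
  (multiplicity-safe: a multiple off-line zero only HELPS; the funnel's birth stub `stub_hadamardLocal`
  `|Z'/Z − 2(t−γ)/((t−γ)²+δ²)| ≤ 3 log²γ` is false for a pair of multiplicity ≥ 2 and is NOT reused);
* stub E `stub_twoPoint` [M] — a sign change of `Z'/Z` from − to + across a zero-free closed interval
  forces a positive local min or a negative local max inside (C1² S3, PROVED folder-locally).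

`Dictionary_of` is then REAL ARITHMETIC (T1's pen estimate «pair term ∓1/δ ≥ 4 log²γ vs the rest
≲ 0.7 log²γ», tribunal-rh STATUS l.251, made kernel-checked).  With `L = log γ ≥ 28` (`e < 2.72`,
`2.72²⁸ < H₀`), thinness gives `1/δ ≥ 4L²`, `δL ≤ 1/112`, `δ ≤ 1/3136`; the isolation radius
`r = π/L` has `2δ ≤ r` and `1/(r−δ) ≤ L/3`; the window count is cited BY NAME
(`ZetaZeroWindows.count_diff_le_explicit`, T = t−1 ≥ 30, H = 2): `N(t+1) − N(t−1) ≤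
(1/π)log((t+1)/2π) + 0.6166 log(t+1) + 6.506 ≤ L + 8`.  BUDGET at `t = γ ± δ` (units of 1):

  | piece                         | bound used in `Dictionary_of`        | at L = 28.73 |
  |-------------------------------|--------------------------------------|--------------|
  | pair `½±δ+iγ` (stub D)        | ≥ 1/δ − 2δ ≥ 4L² − 0.001             |  ≥ 3301      |
  | other window zeros (stub D)   | ≤ (L+8)(L/3+1/2) = L²/3 + 19L/6 + 4  |  ≤ 371       |
  | far field (stub B)            | ≤ 20 log t + 50 ≤ 20(L+1) + 50       |  ≤ 645       |
  | smooth part (stub C)          | ≤ 3                                  |  ≤ 3         |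

so `Z'/Z(γ+δ) ≥ (11/3)L² − (139/6)L − 78 > 0` and `Z'/Z(γ−δ) < 0` for `L ≥ 28` (margin ×3.2; the
inequality closes for every L ≥ 9).  `Z ≠ 0` on `[γ−δ, γ+δ]` (a zero of `Z` is a zero of ζ ON the line
within δ < π/L of γ, excluded by isolation since δ ≠ 0), stub E gives the violation at some
`t ∈ (γ−δ, γ+δ)`, and `|t−γ| < δ < π/L`.

## CONSTANTS RECONCILIATION (remit (CA132) (2))

The route types thinness `δ·log²γ ≤ c` with `c = 1/4`, isolation radius `C/log γ` with `C = π`,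
and `γ > H₀ = 3 000 175 332 800` (so `L = log γ ≥ 28.73`).  On this line the provable constants
IMPLY the route's, with room: `Dictionary_of` only needs
`1/δ − 2δ > (L+8)(L/3+1/2) + 20(L+1) + 50 + 3 (= 1018 at L = 28.73)`, i.e. it would still close
with thinness constant `c' = 0.8` at `L = 28.73` (and `c' → 3` as `L → ∞`, the cluster coefficient
being `1/3 + O(1/L)` per `log²γ`: window law `(1/π + 0.6166) log t + 6.5` per 2-window times the
kernel bound `1/(r−δ) + 1/2 ≤ L/3 + 1/2`); the radius enters only through `1/(r−δ) ≤ L/3`, and any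
`C ≥ 3.1` works verbatim.  In the C1²/C2² currency `c = min(½, 1/(4(2A₁+2A)))` this line has NO
Landau constant `A` at all (no disc lemma; the far field is `O(log t) = o(log²t)` with explicit
`20 log t + 50`), which is why `c = 1/4` is far inside instead of marginal.  Verdict: NO `--restate`
of `Dictionary` is needed for this line; H₀ is used only as `log γ ≥ 28` (any `H₀ ≥ e⁹` would do
for the arithmetic, the route's H₀ is Platt–Trudgian's RH height and stays).  The sharper C2² window
law `window_le_hsw_proved` (A₁ = 0.2070, Sketch 154cb6982046ad51; slot-(9) leaf
`ZetaZeroWindowsHSWDirect.lean`, NOT yet in the tree) is not needed; when it lands it can replace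
`ZetaZeroWindows.count_diff_le_explicit` inside the helper `window_count_le` and nothing else moves.

## Numerical sanity check (pure python, folder `num/check_identity.py`, 30 000 zeros γ ≤ 25 755)

identity of stub A at t ∈ {100.3, 237.9, 500.25, 1001.7, 3000.4}: |Z'/Z − (window+far+smooth)|
≤ 6·10⁻⁹ (finite-difference noise); |farSum| ≤ 0.36 (bound 20 log t + 50 ≥ 142); |smoothPart| ≤ 0.55
at t ≤ 24 000 (bound 3); pair kernels `K(γ±δ, ½±δ+iγ) ≷ ±(1/(2δ) − δ)` and the window-kernel bound
`|K| ≤ 1/|t−γ′| + 1/2` confirmed on 2·10⁴ random samples.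

## Inputs of record (read; cited by sha16)

funnel birth `plan-w07-sigmaL-1/lines/Dictionary_birth.lean` 72a033fbdba99728 (stub_hadamardLocal XL +
stub_twoPoint M; registered on the item); C1² Skeleton b7360717bb8c5e1d + S3 standalone ad2d3dd1f14bf951
(`signChangeViolation` PROVED); C1 Birth-24248 rev 2 a763f0de9f863b85 (critic PASS skeleton-birth, STATUS
l.5346; its `dictionary_of_explicit` arithmetic is the model for `Dictionary_of` below — log γ ≥ 28 from
`exp 1 < 2.72`, `log(γ+δ) ≤ log γ + 1`), current rev 53e3a0de29918e0a; C2² Sketch 154cb6982046ad51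
(`window_le_hsw_proved`); critic CONSTANTS WORD dossier 1add1f3919aeae9d (rh-split STATUS l.5346).

## PRESEARCH (corpus fts+vec, galaxy, tree; 2026-08-29)

* stub A: [corpus:book:titchmarsh1986 p.158–159] §9.6 second proof of Thm 9.6 (A) (differencing at
  2+it), [corpus:book:titchmarsh1986 p.26] (2.12.7); [corpus:book:montgomery2007-multiplicative-number-
  theory-i p.313] (MV §12.1 local formula, the DISC alternative); [corpus:paper:arxiv-math_0311162 p.3]
  Ivić 2003 §2 (2.1)–(2.2) `Z'/Z` via `ξ'/ξ`; tree: `Ivic2003.deriv_hardyZ_div_eq`,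
  `Ivic2003.neg_im_logDeriv_zeta_critPt`, `logDeriv_riemannXi_eq`, `logDeriv_riemannZeta₁_eq_of_one_lt_re`,
  `hasSum_zeroOrder_mul_re_inv_sub` (multiplicity bookkeeping pattern, Re-version),
  `exists_isHadamardSeq`, `IsHadamardSeq.logDeriv_riemannXi_eq_tsum_pairs`, `summable_pairs`.
  → the Im/differenced version is NOT in the tree (queries: rg "inv_sub.*im", "logDeriv_riemannXi.*sub").
* stub B: [corpus:book:titchmarsh1986 p.159] shell sum display, [corpus:book:titchmarsh1986 p.154]
  Thm 9.2; tree `zetaZeroCount_window_le_three_log`, `ZetaZeroWindows.count_diff_le_explicit`,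
  `FarZeros.sum_le_zetaZeroCount_sub`, `ZetaZeroSum.summable_zeroOrder_div_one_add_sq`,
  `riemannZetaZeroOrder_conj_holds`; galaxy "Lehmer's phenomenon|…" → [galaxy:panama:429788787376218]
  Edwards (§8.3), [galaxy:panama:500466769199130] Motohashi (ed.) LMS 247 (Ivić 1997) — no explicit
  far-field constant in print for σ = ½ found (queries "zeta'/zeta sum over zeros |t-gamma|<=1 O(log t)",
  corpus hybrid 8 hits, all O-form).
* stub C: tree `Literature.Analysis.SpecialFunctions.Complex.abs_im_digamma_le` (|Im ψ(w)| ≤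
  |Im w|/‖w‖² + π/2) [cite AndrewsAskeyRoy1999 Thm 1.2.5], `hasSum_im_digamma`,
  `norm_deriv_riemannZeta_div_lt` (Ford 2002 L3.1: |ζ'/ζ(s)| < 1/(σ−1)); Titchmarsh p.158 "by a known
  property of the Γ-function".
* stub D: [corpus:paper:arxiv-math_0311162 p.3–4] Ivić §2 (pair/Lehmer mechanism); Edwards §8.3
  [galaxy:panama:429788787376218]; tree `zetaZeroCount_sub_eq_finsum`, `zetaZeroBox_diff_eq`,
  `GeneralizedRH.riemannZeta_one_sub_eq_zero` / `riemannZeta_conj` (partner zero ½−δ+iγ),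
  `zetaZeroBox_subset_riemannZetaNontrivialZeros`, `re_mem_Ioo_of_riemannZeta_eq_zero_of_im_ne_zero`.
* stub E: C1² S3 `RhIdea5.G14.W07C2.S3.stub_signChangeViolation` ad2d3dd1f14bf951 PROVED and
  `RhIdea5.G15.Birth24248.signChangeViolation` (Birth rev 2 l.459–531) PROVED — port verbatim; tree
  `continuous_hardyZ`, Mathlib `IsCompact.exists_isMinOn`, `hasDerivAt_iff_tendsto_slope`.

Disproof used: none exists (`ledger crux ls stmt-RiemannHypothesis-24248`: no workfiles, 08:58Z);
negatives index (7 entries) unrelated.  Dead lines honoured: birth `stub_hadamardLocal` (two-sided,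
multiplicity-unsafe) replaced by one-sided stub D; tree `sum_kernel_le_explicit` (constant 144 ⇒ ≈ 15 log²γ)
not used for the far field; the ξ-direct undifferenced Im-series (conditionally convergent) not used.
-/

noncomputable section

open Complex Set Filter Topology
open Literature.NumberTheory.LFunctions

namespace Summit.RiemannHypothesis.RiemannHypothesis.Cruxes.Dictionary.DictionaryV1

/-! ## The objects of the line (transparent abbreviations; all data from the tree) -/

/-- The critical point `½ + it`. -/
def critPt (t : ℝ) : ℂ := 1 / 2 + (t : ℂ) * I

/-- Titchmarsh's comparison point `2 + it`. -/
def cmpPt (t : ℝ) : ℂ := 2 + (t : ℂ) * I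

/-- The differenced kernel `K(t,ρ) = −Im[1/(½+it−ρ) − 1/(2+it−ρ)]` (Titchmarsh §9.6, second proof). -/
def kernel (t : ℝ) (ρ : ℂ) : ℝ := -((1 / (critPt t - ρ) - 1 / (cmpPt t - ρ)).im)

/-- The window of zeros `t − 1 < Im ρ ≤ t + 1` (each zero once; tree boxes `zetaZeroBox 0 ·`). -/
def window (t : ℝ) : Set ℂ := zetaZeroBox 0 (t + 1) \ zetaZeroBox 0 (t - 1)

/-- The window sum `Σ_{ρ ∈ window t} m(ρ)·K(t,ρ)` (finite: `zetaZeroBox_finite`). -/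
def windowSum (t : ℝ) : ℝ := ∑ᶠ ρ ∈ window t, (riemannZetaZeroOrder ρ : ℝ) * kernel t ρ

open Classical in
/-- The far-field summand on the subtype of non-trivial zeros (tree convention of
`hasSum_zeroOrder_mul_re_inv_sub`): `m(ρ)·K(t,ρ)` off the window, `0` on it. -/
def farTerm (t : ℝ) (ρ : RHWave0.riemannZetaNontrivialZeros) : ℝ :=
  if (ρ : ℂ) ∈ window t then 0 else (riemannZetaZeroOrder (ρ : ℂ) : ℝ) * kernel t ρ

/-- The far-field sum `Σ_{ρ ∉ window t} m(ρ)·K(t,ρ)` (absolutely convergent, stub A). -/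
def farSum (t : ℝ) : ℝ := ∑' ρ, farTerm t ρ

/-- The smooth part: `−Im ζ'/ζ(2+it) − Im 1/(2+it) − Im 1/(1+it) − ½ Im ψ(1+it/2) − 2t/(t²+¼)
+ ½ Im ψ(¼+it/2)` (the `s₀`-side of `ξ'/ξ(s₀)` by `logDeriv_riemannXi_eq`, and the ζ→ξ conversion at
`½+it` by `Ivic2003.neg_im_logDeriv_zeta_critPt`). -/
def smoothPart (t : ℝ) : ℝ :=
  -(deriv riemannZeta (cmpPt t) / riemannZeta (cmpPt t)).im - (1 / cmpPt t).im
    - (1 / (cmpPt t - 1)).im - (Complex.digamma (cmpPt t / 2)).im / 2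
    - 2 * t / (t ^ 2 + 1 / 4) + (Complex.digamma ((1 / 4 : ℂ) + ((t / 2 : ℝ) : ℂ) * I)).im / 2

/-! ## The five registered stubs (sorry ONLY here) -/

/-- **stub A [L] — exact partial-fraction decomposition of `Z'/Z` on the critical line, differenced at
`2 + it`** (Titchmarsh 1986 §9.6, second proof of Thm 9.6 (A), PDF p.158–159; (2.12.7) p.26; Ivić 2003
(2.2)).  Proof route: `Ivic2003.deriv_hardyZ_div_eq` + `Ivic2003.neg_im_logDeriv_zeta_critPt` (ζ→ξ at
½+it), `logDeriv_riemannXi_eq` + `logDeriv_riemannZeta₁_eq_of_one_lt_re` + `logDeriv_Gammaℝ` at 2+it,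
and the multiplicity bookkeeping of `hasSum_zeroOrder_mul_re_inv_sub` run with the complex kernel
`ρ ↦ 1/(s−ρ) − 1/(s₀−ρ)` (absolutely summable, `O(1/|ρ|²)`), then split the `HasSum` at the finite
window.  Why it might fail: only Lean plumbing (finsum/tsum splitting over the subtype); the identity is
classical. -/
theorem stub_partialFraction :
    ∀ t : ℝ, 100 ≤ t → riemannZeta (1 / 2 + (t : ℂ) * I) ≠ 0 →
      Summable (farTerm t) ∧
        deriv hardyZ t / hardyZ t = windowSum t + farSum t + smoothPart t := by
  sorry

/-- **stub B [L] — explicit far field** (Titchmarsh §9.6 PDF p.159: unit shells `t+n < γ ≤ t+n+1`,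
`|1/(s−ρ) − 1/(2+it−ρ)| ≤ (3/2)/(t−γ)²`, `Σ_n log(t+n)/n² = O(log t)`; Thm 9.2 p.154).  Tree inputs:
`zetaZeroCount_window_le_three_log` (N(u+1) − N(u) ≤ 3 log(|u|+2), every real u),
`FarZeros.sum_le_zetaZeroCount_sub`, `ZetaZeroSum.summable_zeroOrder_div_one_add_sq`,
`riemannZetaZeroOrder_conj_holds` (zeros with Im ρ < 0 contribute ≤ (3/2)Σ m/(t+γ)² < 1).  Pencil value
≤ 14.8 log t + 9 for t ≥ 100; the stated 20 log t + 50 leaves room for crude shelling.  Why it might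
fail: a constant slip only — the budget tolerates any `a log t + b` with `a ≤ 60`. -/
theorem stub_farField :
    ∀ t : ℝ, 100 ≤ t → |farSum t| ≤ 20 * Real.log t + 50 := by
  sorry

/-- **stub C [M] — the smooth part is bounded** (Titchmarsh p.158 "by a known property of the
Γ-function"; digamma series AndrewsAskeyRoy1999 Thm 1.2.5).  Tree inputs BY NAME:
`norm_deriv_riemannZeta_div_lt` (|ζ'/ζ(2+it)| < 1, Ford 2002 L3.1),
`Literature.Analysis.SpecialFunctions.Complex.abs_im_digamma_le` (|Im ψ(w)| ≤ |Im w|/‖w‖² + π/2 for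
Re w > 0), and `|Im 1/(2+it)|, |Im 1/(1+it)|, 2t/(t²+¼) ≤ 2/t`.  Pencil value ≤ 1 + π/2 + 6/t < 2.7.
Why it might fail: it cannot for t ≥ 100 (each term bounded by name); size is the only risk. -/
theorem stub_smoothBound :
    ∀ t : ℝ, 100 ≤ t → |smoothPart t| ≤ 3 := by
  sorry

/-- **stub D [M] — pair and cluster signs of the window sum under pair-isolation** (Ivić 2003 §2;
Edwards 1974 §8.3; the route's `Dictionary` hypotheses with a free isolation radius `r ≥ 2δ`).  At
`t = γ+δ` each of the two pair zeros `½±δ+iγ` (the partner by `riemannZeta_one_sub` + `riemannZeta_conj`)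
lies in `window t` and contributes `m·(1/(2δ) + Im 1/(2+it−ρ)) ≥ 1/(2δ) − δ` (m ≥ 1 only helps); every
other window zero has `0 < Re ρ < 1` (`re_mem_Ioo_of_riemannZeta_eq_zero_of_im_ne_zero`), hence by
isolation `|Im ρ − γ| ≥ r`, so `|K(t,ρ)| ≤ 1/(r−δ) + 1/2`; the multiplicities in the window total
`N(t+1) − N(t−1)` (`zetaZeroCount_sub_eq_finsum`).  Symmetrically at `t = γ−δ`.  ONE-SIDED, hence
multiplicity-safe (replaces the funnel's two-sided `stub_hadamardLocal`).  Why it might fail: only if a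
window-membership edge case (Im ρ = t±1) is mis-booked — the bounds have slack `2δ`. -/
theorem stub_clusterSigns :
    ∀ γ δ r : ℝ, 100 ≤ γ → 0 < δ → δ < 1 / 2 → 2 * δ ≤ r →
      riemannZeta (1 / 2 + δ + γ * I) = 0 →
      (∀ s : ℂ, riemannZeta s = 0 → 0 < s.re → s.re < 1 → |s.im - γ| < r →
        s.im = γ ∧ (s.re = 1 / 2 + δ ∨ s.re = 1 / 2 - δ)) →
      1 / δ - 2 * δ
          - ((zetaZeroCount (γ + δ + 1) : ℝ) - zetaZeroCount (γ + δ - 1)) * (1 / (r - δ) + 1 / 2)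
          ≤ windowSum (γ + δ) ∧
      windowSum (γ - δ) ≤
        -(1 / δ) + 2 * δ
          + ((zetaZeroCount (γ - δ + 1) : ℝ) - zetaZeroCount (γ - δ - 1)) * (1 / (r - δ) + 1 / 2) := by
  sorry

/-- **stub E [M] — two-point sign change ⇒ Lehmer violation** (Edwards 1974 §8.3; Ivić 2003 §2):
if `Z ≠ 0` on `[a,b]` and `Z'/Z(a) < 0 < Z'/Z(b)`, then `Z` has a positive local minimum or a negative
local maximum in `(a,b)` (constant sign by IVT; `Z'(a)`, `Z'(b)` point inward; extreme value theorem).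
PROVED folder-locally: C1² S3 `RhIdea5.G14.W07C2.S3.stub_signChangeViolation` (ad2d3dd1f14bf951) and
`RhIdea5.G15.Birth24248.signChangeViolation` (Birth rev 2 a763f0de9f863b85, l.426–531) — port verbatim
(`continuous_hardyZ`, `IsCompact.exists_isMinOn`, `hasDerivAt_iff_tendsto_slope`).  Why it might fail:
it cannot; it is a port. -/
theorem stub_twoPoint :
    ∀ a b : ℝ, a < b → (∀ t ∈ Set.Icc a b, hardyZ t ≠ 0) →
      deriv hardyZ a / hardyZ a < 0 → 0 < deriv hardyZ b / hardyZ b →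
        ∃ t ∈ Set.Ioo a b,
          (IsLocalMin hardyZ t ∧ 0 < hardyZ t) ∨ (IsLocalMax hardyZ t ∧ hardyZ t < 0) := by
  sorry

/-! ## Glue (PROVED) -/

/-- Under pair-isolation at radius `R` with `δ ≠ 0`, `Z` has no zero within `R` of `γ`
(a zero of `Z` is a zero of ζ ON the line, `hardyZ_eq_zero_iff_holds`). -/
theorem hardyZ_ne_zero_of_isolated {γ δ R u : ℝ} (hδ : 0 < δ)
    (hiso : ∀ s : ℂ, riemannZeta s = 0 → 0 < s.re → s.re < 1 → |s.im - γ| < R →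
      s.im = γ ∧ (s.re = 1 / 2 + δ ∨ s.re = 1 / 2 - δ))
    (hu : |u - γ| < R) : hardyZ u ≠ 0 := by
  intro hZ
  have hz : riemannZeta (1 / 2 + u * I) = 0 := (hardyZ_eq_zero_iff_holds u).1 hZ
  have h := hiso (1 / 2 + u * I) hz (by simp) (by simp; norm_num) (by simpa using hu)
  rcases h.2 with h1 | h1 <;> simp at h1 <;> linarith

/-- `28 ≤ log γ` for `γ > 3 000 175 332 800` (`e < 2.72`, `2.72²⁸ < 3·10¹²`). -/
theorem log_ge_28 {γ : ℝ} (hγ : 3000175332800 < γ) : 28 ≤ Real.log γ := by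
  have hγpos : 0 < γ := by linarith
  rw [Real.le_log_iff_exp_le hγpos]
  have h1 := Real.exp_one_lt_d9
  have e : Real.exp 28 = Real.exp 1 ^ 28 := by rw [← Real.exp_nat_mul]; norm_num
  rw [e]
  have h2 : Real.exp 1 ^ 28 < (2.72 : ℝ) ^ 28 :=
    pow_lt_pow_left₀ (by linarith) (Real.exp_pos 1).le (by norm_num)
  have h3 : (2.72 : ℝ) ^ 28 < 3000175332800 := by norm_num
  linarith

/-- The explicit window law of the tree, in the shape used twice below: for `t ≥ 31` with
`t + 1 ≤ 2γ`, `N(t+1) − N(t−1) ≤ log γ + 8` (`ZetaZeroWindows.count_diff_le_explicit`, T = t−1, H = 2;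
`(1/π) log((t+1)/2π) + 0.6166 log(t+1) + 6.506 ≤ 0.95 (log γ + 1) + 6.51`). -/
theorem window_count_le {γ t : ℝ} (hγ : 1 ≤ γ) (ht : 31 ≤ t) (htγ : t + 1 ≤ 2 * γ) :
    (zetaZeroCount (t + 1) : ℝ) - zetaZeroCount (t - 1) ≤ Real.log γ + 8 := by
  have hπ3 := Real.pi_gt_three
  have hπpos := Real.pi_pos
  have hcnt := ZetaZeroWindows.count_diff_le_explicit (T := t - 1) (H := 2) (by linarith) (by norm_num)
  have e1 : t - 1 + 2 = t + 1 := by ring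
  rw [e1] at hcnt
  have hlog2 : Real.log 2 ≤ 1 := by have := Real.log_two_lt_d9; linarith
  have hL0 : 0 ≤ Real.log γ := Real.log_nonneg hγ
  have hlt1 : Real.log (t + 1) ≤ Real.log γ + 1 := by
    have h1 : Real.log (t + 1) ≤ Real.log (2 * γ) := Real.log_le_log (by linarith) htγ
    rw [Real.log_mul (by norm_num) (by linarith)] at h1
    linarith
  have hlt0 : 0 ≤ Real.log (t + 1) := Real.log_nonneg (by linarith)
  have hq : Real.log ((t + 1) / (2 * Real.pi)) ≤ Real.log (t + 1) := by
    refine Real.log_le_log (by positivity) ?_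
    exact div_le_self (by linarith) (by linarith)
  have hc : 2 / (2 * Real.pi) ≤ 1 / 3 := by
    rw [div_le_div_iff₀ (by positivity) (by norm_num)]
    linarith
  have hc0 : 0 ≤ 2 / (2 * Real.pi) := by positivity
  have i1 : 2 / (2 * Real.pi) * Real.log ((t + 1) / (2 * Real.pi)) ≤ 1 / 3 * Real.log (t + 1) := by
    calc 2 / (2 * Real.pi) * Real.log ((t + 1) / (2 * Real.pi))
        ≤ 2 / (2 * Real.pi) * Real.log (t + 1) := mul_le_mul_of_nonneg_left hq hc0
      _ ≤ 1 / 3 * Real.log (t + 1) := mul_le_mul_of_nonneg_right hc hlt0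
  linarith

set_option maxHeartbeats 400000 in
open Summit.RiemannHypothesis.RiemannHypothesis.Theses in
/-- **COMPOSITION (kernel-checked; no sorry of its own): the five registered stubs ⇒
`HardyZLehmerSplit.Dictionary` BY NAME** — `stub_partialFraction`, `stub_farField`, `stub_smoothBound`,
`stub_clusterSigns`, `stub_twoPoint` are invoked by name (skeleton-check shape, as in
`Cruxes/QuarticSampleLandau/Lines/quartic_chord.lean`); everything else is the explicit arithmetic of
the budget table in the module docstring. -/
theorem Dictionary_of : HardyZLehmerSplit.Dictionary := by
  have hA := stub_partialFraction
  have hB := stub_farField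
  have hC := stub_smoothBound
  have hD := stub_clusterSigns
  have hE := stub_twoPoint
  intro γ δ hγ hδ hδhalf hzero hthin hiso
  have hγpos : 0 < γ := by linarith
  have hL28 : 28 ≤ Real.log γ := log_ge_28 hγ
  set L := Real.log γ with hLdef
  have hLpos : 0 < L := by linarith
  have hπ3 := Real.pi_gt_three
  have hπ314 := Real.pi_gt_d2
  have hπpos : 0 < Real.pi := Real.pi_pos
  -- thinness consequences
  have hb1 : δ * L ^ 2 ≤ 1 / 4 := hthin
  have hb2 : δ * L ≤ 1 / 112 := by
    have : δ * L * 28 ≤ δ * L * L := mul_le_mul_of_nonneg_left hL28 (by positivity)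
    nlinarith
  have hb3 : δ ≤ 1 / 3136 := by
    have : δ * 784 ≤ δ * L ^ 2 := mul_le_mul_of_nonneg_left (by nlinarith) hδ.le
    linarith
  have hinv : 4 * L ^ 2 ≤ 1 / δ := by
    rw [le_div_iff₀ hδ]
    linarith
  have hL2 : 28 * L ≤ L ^ 2 := by nlinarith
  -- the isolation radius r = π / L
  set r := Real.pi / L with hrdef
  have hrpos : 0 < r := by positivity
  have hLr : L * r = Real.pi := by rw [hrdef]; field_simp
  have h2δ : 2 * δ ≤ r := by
    have : 2 * δ * L ≤ r * L := by linarith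
    exact le_of_mul_le_mul_right this hLpos
  have hδr : δ < r := by linarith
  have hrδ : 0 < r - δ := by linarith
  have hker : 1 / (r - δ) ≤ L / 3 := by
    rw [div_le_div_iff₀ hrδ (by norm_num)]
    have e : L * (r - δ) = Real.pi - δ * L := by rw [mul_sub, hLr]; ring
    linarith
  have hfac : 1 / (r - δ) + 1 / 2 ≤ L / 3 + 1 / 2 := by linarith
  have hfac0 : 0 ≤ 1 / (r - δ) + 1 / 2 := by positivity
  -- `Z ≠ 0` on `[γ − δ, γ + δ]`, hence `ζ(½ + i(γ ± δ)) ≠ 0`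
  have hZne : ∀ u ∈ Set.Icc (γ - δ) (γ + δ), hardyZ u ≠ 0 := by
    intro u hu
    refine hardyZ_ne_zero_of_isolated hδ hiso ?_
    have : |u - γ| ≤ δ := abs_le.mpr ⟨by linarith [hu.1], by linarith [hu.2]⟩
    linarith
  have hζp : riemannZeta (1 / 2 + ((γ + δ : ℝ) : ℂ) * I) ≠ 0 := fun h0 ↦
    hZne (γ + δ) ⟨by linarith, le_rfl⟩ ((hardyZ_eq_zero_iff_holds (γ + δ)).2 h0)
  have hζm : riemannZeta (1 / 2 + ((γ - δ : ℝ) : ℂ) * I) ≠ 0 := fun h0 ↦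
    hZne (γ - δ) ⟨le_rfl, by linarith⟩ ((hardyZ_eq_zero_iff_holds (γ - δ)).2 h0)
  -- logarithms at `γ ± δ`
  have hlog2 : Real.log 2 ≤ 1 := by have := Real.log_two_lt_d9; linarith
  have hlogp : Real.log (γ + δ) ≤ L + 1 := by
    have h1 : Real.log (γ + δ) ≤ Real.log (2 * γ) := Real.log_le_log (by linarith) (by linarith)
    rw [Real.log_mul (by norm_num) hγpos.ne'] at h1
    linarith
  have hlogm : Real.log (γ - δ) ≤ L + 1 := by
    have h1 : Real.log (γ - δ) ≤ Real.log γ := Real.log_le_log (by linarith) (by linarith)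
    linarith
  -- the five inputs at `t = γ ± δ`
  obtain ⟨-, hdecp⟩ := hA (γ + δ) (by linarith) hζp
  obtain ⟨-, hdecm⟩ := hA (γ - δ) (by linarith) hζm
  have hfarp := (abs_le.mp (hB (γ + δ) (by linarith))).1
  have hfarm := (abs_le.mp (hB (γ - δ) (by linarith))).2
  have hsmp := (abs_le.mp (hC (γ + δ) (by linarith))).1
  have hsmm := (abs_le.mp (hC (γ - δ) (by linarith))).2
  obtain ⟨hplus, hminus⟩ :=
    hD γ δ r (by linarith) hδ hδhalf h2δ hzero hiso
  -- window counts BY NAME (`ZetaZeroWindows.count_diff_le_explicit`)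
  have hWp : (zetaZeroCount (γ + δ + 1) : ℝ) - zetaZeroCount (γ + δ - 1) ≤ L + 8 :=
    window_count_le (γ := γ) (t := γ + δ) (by linarith) (by linarith) (by linarith)
  have hWm : (zetaZeroCount (γ - δ + 1) : ℝ) - zetaZeroCount (γ - δ - 1) ≤ L + 8 :=
    window_count_le (γ := γ) (t := γ - δ) (by linarith) (by linarith) (by linarith)
  have hWp0 : 0 ≤ (zetaZeroCount (γ + δ + 1) : ℝ) - zetaZeroCount (γ + δ - 1) := by
    have : (zetaZeroCount (γ + δ - 1) : ℝ) ≤ zetaZeroCount (γ + δ + 1) := by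
      exact_mod_cast zetaZeroCount_mono (by linarith : γ + δ - 1 ≤ γ + δ + 1)
    linarith
  have hWm0 : 0 ≤ (zetaZeroCount (γ - δ + 1) : ℝ) - zetaZeroCount (γ - δ - 1) := by
    have : (zetaZeroCount (γ - δ - 1) : ℝ) ≤ zetaZeroCount (γ - δ + 1) := by
      exact_mod_cast zetaZeroCount_mono (by linarith : γ - δ - 1 ≤ γ - δ + 1)
    linarith
  have hexp : (L + 8) * (L / 3 + 1 / 2) = L ^ 2 / 3 + 19 * L / 6 + 4 := by ring
  have hclp : ((zetaZeroCount (γ + δ + 1) : ℝ) - zetaZeroCount (γ + δ - 1)) * (1 / (r - δ) + 1 / 2)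
      ≤ L ^ 2 / 3 + 19 * L / 6 + 4 := by
    rw [← hexp]; exact mul_le_mul hWp hfac hfac0 (by linarith)
  have hclm : ((zetaZeroCount (γ - δ + 1) : ℝ) - zetaZeroCount (γ - δ - 1)) * (1 / (r - δ) + 1 / 2)
      ≤ L ^ 2 / 3 + 19 * L / 6 + 4 := by
    rw [← hexp]; exact mul_le_mul hWm hfac hfac0 (by linarith)
  -- the budget: `Z'/Z(γ+δ) > 0`, `Z'/Z(γ−δ) < 0`
  have hpos : 0 < deriv hardyZ (γ + δ) / hardyZ (γ + δ) := by
    rw [hdecp]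
    linarith
  have hneg : deriv hardyZ (γ - δ) / hardyZ (γ - δ) < 0 := by
    rw [hdecm]
    linarith
  obtain ⟨t, ht, hviol⟩ := hE (γ - δ) (γ + δ) (by linarith) hZne hneg hpos
  refine ⟨t, ?_, hviol⟩
  have : |t - γ| < δ := abs_lt.mpr ⟨by linarith [ht.1], by linarith [ht.2]⟩
  linarith

#harness_tags Dictionary_of

end Summit.RiemannHypothesis.RiemannHypothesis.Cruxes.Dictionary.DictionaryV1

end
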